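import Summits.ValiantsHypothesis.ValiantsHypothesis.Theorems.LacunarySymmetroidMatrixDescartesStubDescartesCeiling
import Summits.ValiantsHypothesis.ValiantsHypothesis.Theorems.LacunarySymmetroidMatrixDescartesCensusSignSplitInconsistent

/-!
# The pencil-plane law: lacunary matrix pencils of span rank ≤ 2 have at most `m(K−1)` positive roots

Census currency of crux `MatrixDescartes` (stmt-18050), line `span-rank` (ideator val-idea-1, D-0148 (a)): the
FIRST RUNG `stub_pencilPlane` and the support stub `stub_spanOne` of `Cruxes/MatrixDescartes/Lines/span_rank.lean`,
proved for all formats.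

* `SpanRootLawAt m K r bound` (token-identical to the line file): every `K`-letter `m × m` lacunary pencil whose
  letters lie in the span of `r` fixed matrices `B_i` has at most `bound` distinct positive roots of its
  determinant (`Census.SignSplit.posRootCount`, no symmetry hypothesis).
* `spanRootLawAt_two : SpanRootLawAt m K 2 (m * (K - 1))` — two-matrix nets `p(x) A + q(x) B` (`p, q` K-nomials on
  the common support `d`): a positive root with `q(x) ≠ 0` makes `p(x)/q(x)` a real root `μ` of
  `φ(λ) = det(λ A + B)` (`natDegree φ ≤ m`, and `≤ m − 1` when `det A = 0` by
  `Polynomial.coeff_det_X_add_C_card`), hence `x` a positive root of the K-nomial `p − μ q` (≤ `K − 1` each,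
  `stub_descartesCeiling` on `1 × 1` pencils); roots with `q(x) = 0` are roots of `q` (paid for by the missing
  degree when `det A = 0`) or common roots of `p, q` (already counted when `det A ≠ 0` and `φ` has a real root;
  the only roots otherwise).
* `spanRootLawAt_one : SpanRootLawAt m K 1 (K - 1)`.  0 sorry; nothing here asserts B / `MatrixDescartes`.
-/

set_option linter.dupNamespace false
set_option linter.unusedVariables false
set_option linter.unusedSectionVars false

namespace Summit.ValiantsHypothesis.ValiantsHypothesis.Theorems.LacunarySymmetroidMatrixDescartes.Census.SpanRank

open Polynomial Matrix Finset
open scoped BigOperators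
open Summit.ValiantsHypothesis.ValiantsHypothesis.Theorems.LacunarySymmetroidMatrixDescartes.Census.SignSplit
  (pencil posRootCount)

/-- **Span-rank root law at format `(m, K)` and span rank `r`** (token-identical to
`Cruxes/MatrixDescartes/Lines/span_rank.lean`): letters `S_l = Σ_i c_{l i} B_i` in the span of `r` fixed matrices
have `posRootCount ≤ bound`. [ideator val-idea-1, line span-rank] -/
def SpanRootLawAt (m K r bound : ℕ) : Prop :=
  ∀ (d : Fin K → ℕ) (B : Fin r → Matrix (Fin m) (Fin m) ℝ) (c : Fin K → Fin r → ℝ),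
    posRootCount d (fun l => ∑ i, c l i • B i) ≤ bound

/-- The K-nomial `Σ_l u_l X^{d_l}`. -/
noncomputable def knom {K : ℕ} (d : Fin K → ℕ) (u : Fin K → ℝ) : ℝ[X] := ∑ l, C (u l) * (X : ℝ[X]) ^ d l

/-- Evaluation of a K-nomial. [folklore] -/
theorem eval_knom {K : ℕ} (d : Fin K → ℕ) (u : Fin K → ℝ) (s : ℝ) :
    (knom d u).eval s = ∑ l, u l * s ^ d l := by
  simp [knom, eval_finsetSum]

/-- Descartes for K-nomials in the census currency: at most `K − 1` distinct positive roots
(`stub_descartesCeiling` on the `1 × 1` pencil `Σ_l X^{d_l} • [u_l]`). [folklore] -/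
theorem card_posRoots_knom_le {K : ℕ} (hK : 0 < K) (d : Fin K → ℕ) (u : Fin K → ℝ) :
    ((knom d u).roots.toFinset.filter (fun t => 0 < t)).card ≤ K - 1 := by
  have h := stub_descartesCeiling K 1 hK d (fun l => !![u l])
  have hdet : Matrix.det (∑ l, ((Polynomial.X : Polynomial ℝ) ^ d l) • (!![u l] : Matrix (Fin 1) (Fin 1) ℝ).map
      Polynomial.C) = knom d u := by
    rw [Matrix.det_fin_one]
    simp only [knom, Matrix.sum_apply, Matrix.smul_apply, Matrix.map_apply, Matrix.of_apply,
      Matrix.cons_val', Matrix.cons_val_fin_one, Matrix.empty_val', smul_eq_mul]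
    exact Finset.sum_congr rfl fun l _ => mul_comm _ _
  rw [hdet] at h
  have : Nat.choose (1 + K - 1) 1 = K := by
    rw [show 1 + K - 1 = K by omega, Nat.choose_one_right]
  omega

section TwoNet

variable {m K : ℕ} (d : Fin K → ℕ) (a b : Fin K → ℝ) (A B : Matrix (Fin m) (Fin m) ℝ)

/-- The determinant of the net pencil `Σ_l X^{d_l} • (a_l A + b_l B)`. -/
noncomputable def netDet : ℝ[X] := (pencil d (fun l => a l • A + b l • B)).det

/-- `φ(λ) = det(λ A + B)`. -/
noncomputable def phi : ℝ[X] := Matrix.det ((X : ℝ[X]) • A.map C + B.map C)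

/-- `φ(μ) = det(μ A + B)`. [folklore] -/
theorem eval_phi (μ : ℝ) : (phi A B).eval μ = Matrix.det (μ • A + B) := by
  unfold phi
  have h := RingHom.map_det (Polynomial.evalRingHom μ) ((X : ℝ[X]) • A.map C + B.map C)
  rw [Polynomial.coe_evalRingHom] at h
  rw [h]
  congr 1
  ext i j
  simp only [RingHom.mapMatrix_apply, Matrix.map_apply, Matrix.add_apply, Matrix.smul_apply, smul_eq_mul,
    Polynomial.coe_evalRingHom, eval_add, eval_mul, eval_X, eval_C]

/-- Evaluation of the net determinant: `det(p(s) A + q(s) B)`. [folklore] -/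
theorem eval_netDet (s : ℝ) :
    (netDet d a b A B).eval s = Matrix.det ((knom d a).eval s • A + (knom d b).eval s • B) := by
  unfold netDet pencil
  have h := RingHom.map_det (Polynomial.evalRingHom s)
    (∑ l, (X : ℝ[X]) ^ d l • (a l • A + b l • B).map C)
  rw [Polynomial.coe_evalRingHom] at h
  rw [h]
  congr 1
  ext i j
  simp only [RingHom.mapMatrix_apply, Matrix.map_apply, Matrix.sum_apply, Matrix.smul_apply,
    Matrix.add_apply, smul_eq_mul, Polynomial.coe_evalRingHom, eval_finsetSum, eval_mul, eval_pow, eval_X,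
    eval_C, eval_knom]
  simp only [Finset.sum_mul, ← Finset.sum_add_distrib]
  exact Finset.sum_congr rfl fun l _ => by ring

/-- `det(P A + Q B) = Q^m φ(P/Q)` for `Q ≠ 0`. [folklore] -/
theorem det_net_of_ne_zero {P Q : ℝ} (hQ : Q ≠ 0) :
    Matrix.det (P • A + Q • B) = Q ^ m * (phi A B).eval (P / Q) := by
  rw [eval_phi]
  have : P • A + Q • B = Q • ((P / Q) • A + B) := by
    rw [smul_add, smul_smul, mul_div_cancel₀ _ hQ]
  rw [this, Matrix.det_smul, Fintype.card_fin]

/-- `det(P A + 0 B) = P^m det A`. [folklore] -/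
theorem det_net_of_eq_zero (P : ℝ) : Matrix.det (P • A + (0 : ℝ) • B) = P ^ m * Matrix.det A := by
  rw [zero_smul, add_zero, Matrix.det_smul, Fintype.card_fin]

/-- `natDegree φ ≤ m`. [Mathlib `Polynomial.natDegree_det_X_add_C_le`] -/
theorem natDegree_phi_le : (phi A B).natDegree ≤ m := by
  unfold phi
  simpa only [Fintype.card_fin] using Polynomial.natDegree_det_X_add_C_le A B

/-- `det A = 0` and `φ ≠ 0` ⇒ `natDegree φ ≤ m − 1`. [Mathlib `Polynomial.coeff_det_X_add_C_card`] -/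
theorem natDegree_phi_le_pred (hA : Matrix.det A = 0) (hφ : phi A B ≠ 0) : (phi A B).natDegree ≤ m - 1 := by
  have hle := natDegree_phi_le A B
  have hcoeff : (phi A B).coeff m = Matrix.det A := by
    unfold phi
    simpa only [Fintype.card_fin] using Polynomial.coeff_det_X_add_C_card A B
  rcases Nat.lt_or_ge (phi A B).natDegree m with hlt | hge
  · omega
  · exfalso
    have heq : (phi A B).natDegree = m := le_antisymm hle hge
    have : (phi A B).leadingCoeff = 0 := by
      rw [Polynomial.leadingCoeff, heq, hcoeff, hA]
    exact hφ (Polynomial.leadingCoeff_eq_zero.1 this)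

/-- Number of distinct real roots of `φ`: `≤ m`, and `≤ m − 1` when `det A = 0`. [folklore] -/
theorem card_roots_phi_le (hφ : phi A B ≠ 0) :
    (phi A B).roots.toFinset.card ≤ (if Matrix.det A = 0 then m - 1 else m) := by
  have h1 : (phi A B).roots.toFinset.card ≤ (phi A B).natDegree :=
    (Multiset.toFinset_card_le _).trans (Polynomial.card_roots' _)
  split_ifs with hA
  · exact h1.trans (natDegree_phi_le_pred A B hA hφ)
  · exact h1.trans (natDegree_phi_le A B)

/-- The K-nomial `p − μ q` on the common support. -/
theorem knom_sub_smul (μ : ℝ) : knom d a - C μ * knom d b = knom d (fun l => a l - μ * b l) := by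
  simp only [knom, Finset.mul_sum, ← Finset.sum_sub_distrib]
  refine Finset.sum_congr rfl fun l _ => ?_
  rw [C_sub, C_mul]; ring

/-- If `p − μ q ≡ 0` for a root `μ` of `φ`, or if `φ ≡ 0` (with `q ≢ 0`), the net determinant vanishes
identically. [folklore] -/
theorem netDet_eq_zero_of_degenerate
    (h : (∃ μ : ℝ, (phi A B).eval μ = 0 ∧ knom d a - C μ * knom d b = 0) ∨ (phi A B = 0 ∧ knom d b ≠ 0)) :
    netDet d a b A B = 0 := by
  apply Polynomial.eq_zero_of_infinite_isRoot
  rcases h with ⟨μ, hμ, hpq⟩ | ⟨hφ, hq⟩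
  · -- every real number is a root
    have hall : ∀ s : ℝ, (netDet d a b A B).IsRoot s := by
      intro s
      have hps : (knom d a).eval s = μ * (knom d b).eval s := by
        have := congrArg (Polynomial.eval s) hpq
        simp only [eval_sub, eval_mul, eval_C, eval_zero] at this
        linarith
      rw [IsRoot.def, eval_netDet, hps]
      have : (μ * (knom d b).eval s) • A + (knom d b).eval s • B = (knom d b).eval s • (μ • A + B) := by
        rw [smul_add, smul_smul, mul_comm]
      rw [this, Matrix.det_smul, ← eval_phi, hμ, mul_zero]
    exact Set.infinite_of_forall_exists_gt fun s => ⟨s + 1, hall _, by linarith⟩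
  · -- every non-root of q is a root
    have hsub : {s : ℝ | ¬ (knom d b).IsRoot s} ⊆ {s | (netDet d a b A B).IsRoot s} := by
      intro s hs
      simp only [Set.mem_setOf_eq, IsRoot.def] at hs ⊢
      rw [eval_netDet, det_net_of_ne_zero A B hs, hφ, eval_zero, mul_zero]
    refine Set.Infinite.mono hsub ?_
    have hfin : {s : ℝ | (knom d b).IsRoot s}.Finite := by
      have : {s : ℝ | (knom d b).IsRoot s} ⊆ ↑(knom d b).roots.toFinset := by
        intro s hs
        simp only [Finset.mem_coe, Multiset.mem_toFinset, mem_roots', ne_eq, IsRoot.def] at hs ⊢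
        exact ⟨hq, hs⟩
      exact Set.Finite.subset (Finset.finite_toSet _) this
    have := hfin.infinite_compl
    simpa [Set.compl_setOf] using this

/-- The set of distinct positive roots of the net determinant. -/
noncomputable def posRoots : Finset ℝ := (netDet d a b A B).roots.toFinset.filter (fun t => 0 < t)

/-- Membership in `posRoots`. -/
theorem mem_posRoots {t : ℝ} :
    t ∈ posRoots d a b A B ↔ netDet d a b A B ≠ 0 ∧ (netDet d a b A B).eval t = 0 ∧ 0 < t := by
  simp only [posRoots, Finset.mem_filter, Multiset.mem_toFinset, mem_roots', IsRoot.def, ne_eq, and_assoc]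

/-- `m = 0`: the determinant is `1`, no roots. [folklore] -/
theorem posRoots_eq_empty_of_m_zero (hm : m = 0) : posRoots d a b A B = ∅ := by
  subst hm
  have h1 : netDet d a b A B = 1 := by
    unfold netDet
    exact Matrix.det_isEmpty
  simp [posRoots, h1]

/-- The case `q ≡ 0`: the roots are roots of the K-nomial `p`, at most `K − 1`. [folklore] -/
theorem card_posRoots_le_of_b_zero (hK : 0 < K) (hb : knom d b = 0) :
    (posRoots d a b A B).card ≤ K - 1 := by
  classical
  rcases Nat.eq_zero_or_pos m with hm | hm
  · rw [posRoots_eq_empty_of_m_zero d a b A B hm, Finset.card_empty]; exact Nat.zero_le _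
  by_cases hD : netDet d a b A B = 0
  · have : posRoots d a b A B = ∅ := by
      ext t; simp [mem_posRoots, hD]
    rw [this, Finset.card_empty]; exact Nat.zero_le _
  -- evaluation: D(s) = p(s)^m det A
  have hev : ∀ s : ℝ, (netDet d a b A B).eval s = ((knom d a).eval s) ^ m * Matrix.det A := by
    intro s
    rw [eval_netDet, hb, eval_zero, det_net_of_eq_zero]
  -- det A ≠ 0 and p ≢ 0, else D ≡ 0
  have hall0 : (∀ s : ℝ, (netDet d a b A B).eval s = 0) → False := by
    intro h
    apply hD
    apply Polynomial.eq_zero_of_infinite_isRoot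
    exact Set.infinite_of_forall_exists_gt fun s => ⟨s + 1, h _, by linarith⟩
  have hA : Matrix.det A ≠ 0 := by
    intro hA; exact hall0 fun s => by rw [hev, hA, mul_zero]
  have hp : knom d a ≠ 0 := by
    intro hp; exact hall0 fun s => by rw [hev, hp, eval_zero, zero_pow hm.ne', zero_mul]
  have hsub : posRoots d a b A B ⊆ (knom d a).roots.toFinset.filter (fun t => 0 < t) := by
    intro t ht
    rw [mem_posRoots] at ht
    obtain ⟨_, hDt, htpos⟩ := ht
    simp only [Finset.mem_filter, Multiset.mem_toFinset, mem_roots', ne_eq, IsRoot.def]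
    refine ⟨⟨hp, ?_⟩, htpos⟩
    rw [hev] at hDt
    rcases mul_eq_zero.1 hDt with h | h
    · exact (pow_eq_zero_iff hm.ne').1 h
    · exact absurd h hA
  exact (Finset.card_le_card hsub).trans (card_posRoots_knom_le hK d a)

/-- **The pencil-plane law for the net `Σ_l X^{d_l} (a_l A + b_l B)`**: at most `m(K−1)` distinct positive roots
of the determinant. [this file] -/
theorem card_posRoots_le : (posRoots d a b A B).card ≤ m * (K - 1) := by
  classical
  rcases Nat.eq_zero_or_pos m with hm | hm
  · rw [posRoots_eq_empty_of_m_zero d a b A B hm, Finset.card_empty]; exact Nat.zero_le _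
  have hempty : netDet d a b A B = 0 → (posRoots d a b A B).card ≤ m * (K - 1) := by
    intro hD
    have : posRoots d a b A B = ∅ := by
      ext t; simp [mem_posRoots, hD]
    rw [this, Finset.card_empty]; exact Nat.zero_le _
  by_cases hD : netDet d a b A B = 0
  · exact hempty hD
  -- K > 0 (else the pencil is the zero matrix)
  rcases Nat.eq_zero_or_pos K with hK0 | hK
  · subst hK0
    exfalso; apply hD
    haveI : Nonempty (Fin m) := ⟨⟨0, hm⟩⟩
    unfold netDet pencil
    simp [Matrix.det_zero]
  have hKm : K - 1 ≤ m * (K - 1) := Nat.le_mul_of_pos_left _ hm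
  set p := knom d a with hp_def
  set q := knom d b with hq_def
  set φ := phi A B with hφ_def
  -- q ≡ 0
  by_cases hq : q = 0
  · exact (card_posRoots_le_of_b_zero d a b A B hK hq).trans hKm
  -- φ ≡ 0 ⇒ D ≡ 0
  by_cases hφ : φ = 0
  · exact absurd (netDet_eq_zero_of_degenerate d a b A B (Or.inr ⟨hφ, hq⟩)) hD
  set Λ : Finset ℝ := φ.roots.toFinset with hΛ_def
  let piece : ℝ → Finset ℝ := fun μ => (knom d (fun l => a l - μ * b l)).roots.toFinset.filter (fun t => 0 < t)
  have hpiece : ∀ μ, (piece μ).card ≤ K - 1 := fun μ => card_posRoots_knom_le hK d _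
  have hqroots : ((q.roots.toFinset.filter (fun t => 0 < t))).card ≤ K - 1 := card_posRoots_knom_le hK d b
  -- a positive root t of D lies in `piece μ` as soon as `μ ∈ Λ` and `p(t) = μ q(t)`
  have hmem_piece : ∀ (t μ : ℝ), 0 < t → φ.eval μ = 0 → p.eval t = μ * q.eval t → t ∈ piece μ := by
    intro t μ ht hμ hpt
    have hne : knom d (fun l => a l - μ * b l) ≠ 0 := by
      rw [← knom_sub_smul]
      intro h0
      exact hD (netDet_eq_zero_of_degenerate d a b A B (Or.inl ⟨μ, hμ, h0⟩))
    have hev : (knom d (fun l => a l - μ * b l)).eval t = 0 := by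
      rw [← knom_sub_smul, eval_sub, eval_mul, eval_C, ← hp_def, ← hq_def, hpt, sub_self]
    simp only [piece, Finset.mem_filter, Multiset.mem_toFinset, mem_roots', ne_eq, IsRoot.def]
    exact ⟨⟨hne, hev⟩, ht⟩
  -- roots with q(t) ≠ 0
  have key1 : ∀ t : ℝ, 0 < t → (netDet d a b A B).eval t = 0 → q.eval t ≠ 0 → ∃ μ ∈ Λ, t ∈ piece μ := by
    intro t ht hDt hqt
    have h1 : (q.eval t) ^ m * φ.eval (p.eval t / q.eval t) = 0 := by
      rw [hφ_def, hp_def, hq_def, ← det_net_of_ne_zero A B hqt, ← eval_netDet]; exact hDt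
    have hφt : φ.eval (p.eval t / q.eval t) = 0 := by
      rcases mul_eq_zero.1 h1 with h | h
      · exact absurd ((pow_eq_zero_iff hm.ne').1 h) hqt
      · exact h
    refine ⟨p.eval t / q.eval t, ?_, hmem_piece t _ ht hφt ?_⟩
    · simp only [hΛ_def, Multiset.mem_toFinset, mem_roots', ne_eq, IsRoot.def]
      exact ⟨hφ, hφt⟩
    · rw [div_mul_cancel₀ _ hqt]
  -- roots with q(t) = 0 and det A ≠ 0 are roots of p
  have key2 : ∀ t : ℝ, (netDet d a b A B).eval t = 0 → q.eval t = 0 → Matrix.det A ≠ 0 → p.eval t = 0 := by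
    intro t hDt hqt hA
    rw [eval_netDet, ← hq_def, hqt, det_net_of_eq_zero] at hDt
    rcases mul_eq_zero.1 hDt with h | h
    · exact (pow_eq_zero_iff hm.ne').1 h
    · exact absurd h hA
  have hbi : (Λ.biUnion piece).card ≤ Λ.card * (K - 1) := by
    calc (Λ.biUnion piece).card ≤ ∑ μ ∈ Λ, (piece μ).card := Finset.card_biUnion_le
      _ ≤ ∑ μ ∈ Λ, (K - 1) := Finset.sum_le_sum fun μ _ => hpiece μ
      _ = Λ.card * (K - 1) := by rw [Finset.sum_const, smul_eq_mul]
  have hΛ : Λ.card ≤ (if Matrix.det A = 0 then m - 1 else m) := card_roots_phi_le A B hφ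
  by_cases hA : Matrix.det A = 0
  · -- cover by q-roots and the pieces; |Λ| ≤ m - 1
    rw [if_pos hA] at hΛ
    have hcov : posRoots d a b A B ⊆ q.roots.toFinset.filter (fun t => 0 < t) ∪ Λ.biUnion piece := by
      intro t ht
      rw [mem_posRoots] at ht
      obtain ⟨_, hDt, htpos⟩ := ht
      rw [Finset.mem_union]
      by_cases hqt : q.eval t = 0
      · left
        simp only [Finset.mem_filter, Multiset.mem_toFinset, mem_roots', ne_eq, IsRoot.def]
        exact ⟨⟨hq, hqt⟩, htpos⟩
      · right
        obtain ⟨μ, hμ, htμ⟩ := key1 t htpos hDt hqt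
        exact Finset.mem_biUnion.2 ⟨μ, hμ, htμ⟩
    calc (posRoots d a b A B).card
        ≤ (q.roots.toFinset.filter (fun t => 0 < t) ∪ Λ.biUnion piece).card := Finset.card_le_card hcov
      _ ≤ (q.roots.toFinset.filter (fun t => 0 < t)).card + (Λ.biUnion piece).card := Finset.card_union_le _ _
      _ ≤ (K - 1) + (m - 1) * (K - 1) := Nat.add_le_add hqroots (hbi.trans (Nat.mul_le_mul_right _ hΛ))
      _ = m * (K - 1) := by
          obtain ⟨m', rfl⟩ := Nat.exists_eq_add_of_le' hm
          simp only [Nat.add_sub_cancel]; ring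
  · rw [if_neg hA] at hΛ
    by_cases hΛe : Λ = ∅
    · -- no real eigen-roots: only common roots of p and q, inside the roots of q
      have hcov : posRoots d a b A B ⊆ q.roots.toFinset.filter (fun t => 0 < t) := by
        intro t ht
        rw [mem_posRoots] at ht
        obtain ⟨_, hDt, htpos⟩ := ht
        by_cases hqt : q.eval t = 0
        · simp only [Finset.mem_filter, Multiset.mem_toFinset, mem_roots', ne_eq, IsRoot.def]
          exact ⟨⟨hq, hqt⟩, htpos⟩
        · obtain ⟨μ, hμ, _⟩ := key1 t htpos hDt hqt
          rw [hΛe] at hμ; simp at hμ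
      exact ((Finset.card_le_card hcov).trans hqroots).trans hKm
    · obtain ⟨μ₀, hμ₀⟩ := Finset.nonempty_of_ne_empty hΛe
      have hμ₀' : φ.eval μ₀ = 0 := by
        simp only [hΛ_def, Multiset.mem_toFinset, mem_roots', ne_eq, IsRoot.def] at hμ₀
        exact hμ₀.2
      have hcov : posRoots d a b A B ⊆ Λ.biUnion piece := by
        intro t ht
        rw [mem_posRoots] at ht
        obtain ⟨_, hDt, htpos⟩ := ht
        by_cases hqt : q.eval t = 0
        · have hpt := key2 t hDt hqt hA
          exact Finset.mem_biUnion.2 ⟨μ₀, hμ₀, hmem_piece t μ₀ htpos hμ₀' (by rw [hpt, hqt, mul_zero])⟩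
        · obtain ⟨μ, hμ, htμ⟩ := key1 t htpos hDt hqt
          exact Finset.mem_biUnion.2 ⟨μ, hμ, htμ⟩
      exact (Finset.card_le_card hcov).trans (hbi.trans (Nat.mul_le_mul_right _ hΛ))

end TwoNet

/-- **Pencil-plane law** (line `span-rank`, FIRST RUNG `stub_pencilPlane`): every `K`-letter `m × m` lacunary pencil
whose letters span a plane `⟨A, B⟩` has at most `m(K−1)` distinct positive roots of its determinant — all formats,
no symmetry or definiteness hypothesis. [this file] -/
theorem spanRootLawAt_two (m K : ℕ) : SpanRootLawAt m K 2 (m * (K - 1)) := by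
  intro d B c
  have h := card_posRoots_le d (fun l => c l 0) (fun l => c l 1) (B 0) (B 1)
  have hS : (fun l => ∑ i, c l i • B i) = (fun l => c l 0 • B 0 + c l 1 • B 1) := by
    funext l; rw [Fin.sum_univ_two]
  rw [hS]
  exact h

/-- **Span rank one** (line `span-rank`, `stub_spanOne`): letters proportional to one matrix `B` give
`det = p^m det B`, at most `K − 1` positive roots. [this file] -/
theorem spanRootLawAt_one (m K : ℕ) : SpanRootLawAt m K 1 (K - 1) := by
  intro d B c
  rcases Nat.eq_zero_or_pos K with hK0 | hK
  · -- no letters: the pencil is `0` (or `1×…` empty): no positive roots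
    subst hK0
    rcases Nat.eq_zero_or_pos m with hm | hm
    · subst hm
      have : (pencil d (fun l => ∑ i, c l i • B i)).det = 1 := Matrix.det_isEmpty
      unfold posRootCount; rw [this]; simp
    · haveI : Nonempty (Fin m) := ⟨⟨0, hm⟩⟩
      have : (pencil d (fun l => ∑ i, c l i • B i)).det = 0 := by
        unfold pencil; simp [Matrix.det_zero]
      unfold posRootCount; rw [this]; simp
  have h := card_posRoots_le_of_b_zero d (fun l => c l 0) (fun _ => (0 : ℝ)) (B 0) (0 : Matrix (Fin m) (Fin m) ℝ)
    hK (by simp [knom])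
  have hS : (fun l => ∑ i, c l i • B i) = (fun l => c l 0 • B 0 + (0 : ℝ) • (0 : Matrix (Fin m) (Fin m) ℝ)) := by
    funext l; rw [Fin.sum_univ_one, zero_smul, add_zero]
  rw [hS]
  exact h

/-- The pencil-plane law in the census currency (`posRootCount`). [this file] -/
theorem posRootCount_twoNet_le {m K : ℕ} (d : Fin K → ℕ) (a b : Fin K → ℝ) (A B : Matrix (Fin m) (Fin m) ℝ) :
    posRootCount d (fun l => a l • A + b l • B) ≤ m * (K - 1) := card_posRoots_le d a b A B

end Summit.ValiantsHypothesis.ValiantsHypothesis.Theorems.LacunarySymmetroidMatrixDescartes.Census.SpanRank
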